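import Literature.NumberTheory.Sieve.Maynard2016LargeGapsStatements
import Literature.NumberTheory.LFunctions.PrimeNumberTheoremErrorTermProofs
import HarnessLib

/-!
# Maynard 2016, Lemma 3 — the prime-number-theorem input: `#{z < p ≤ V} = (V − z)/log x · (1 + O(e^{−√log₂ x}))`

Topic `Literature/NumberTheory/Sieve`. J. Maynard, *Large gaps between primes*, Ann. of Math. 183
(2016), Lemma 3, asserts uniformly for `z + z/log x ≤ V ≤ x (log x)²` and `m ≤ x`
`#{z < p ≤ V : (mp − 1, P_y) = 1} = (V − z)/log x · 𝔖_y(m) · (1 + O(exp(−(log₂ x)^{1/2})))`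
("a fundamental lemma sieve and the Bombieri–Vinogradov theorem"). The tree PROVES the
Fundamental Lemma (`SieveSequence.fundamental_lemma_uniform_holds`), the Bombieri–Vinogradov theorem
(`BombieriVinogradovStatement_holds`) and the prime number theorem with de la Vallée Poussin's error
term (`LFunctions.ChebyshevThetaDeLaValleePoussin_holds`). This file PROVES the first, purely
prime-number-theoretic input of that deduction — the size `X` of the sifted sequence
`{mp − 1 : z < p ≤ V}`:

* `card_primes_Ioc_core` — with explicit hypotheses: if `|ϑ(t) − t| ≤ C t/(log t)^6` (`t ≥ 2`) and
  `x` is large (quantified growth facts), then for `z + z/log x ≤ V ≤ x log² x`,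
  `|#{z < p ≤ V} − (V − z)/log x| ≤ ¼ e^{−√(log₂ x)} (V − z)/log x`;
* `eventually_card_primes_Ioc` — the same for all sufficiently large `x : ℕ`, unconditionally.

(The relative error is really `O(log₂ x / log x)`, from `log V = log x + O(log₂ x)` on the range;
`e^{−√log₂ x}` is what Lemma 3 records.)

## References

* J. Maynard, *Large gaps between primes*, Ann. of Math. (2) 183 (2016), 915–933; arXiv:1408.5110,
  §2, Lemma 3. [Maynard2016LargeGaps]
* H. L. Montgomery, R. C. Vaughan, *Multiplicative Number Theory I*, CUP 2007, Theorem 6.9.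
  [MontgomeryVaughan2007]
-/

open Filter Finset
open scoped Topology

namespace Literature.NumberTheory.Sieve

namespace Maynard2016

/-- `ϑ(B) − ϑ(B′) = Σ_{B′ < p ≤ B} log p`. [folklore] -/
private theorem theta_sub_theta_eq₆ {B' B : ℝ} (h : B' ≤ B) :
    Chebyshev.theta B - Chebyshev.theta B' =
      ∑ p ∈ (Finset.Ioc ⌊B'⌋₊ ⌊B⌋₊).filter Nat.Prime, Real.log p := by
  have hfl : ⌊B'⌋₊ ≤ ⌊B⌋₊ := Nat.floor_mono h
  have hθ : ∀ t : ℝ, Chebyshev.theta t =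
      ∑ p ∈ (Finset.Ioc 0 ⌊t⌋₊).filter Nat.Prime, Real.log p := fun t => rfl
  have e : ∀ a b : ℕ, ∑ p ∈ (Finset.Ioc a b).filter Nat.Prime, Real.log p =
      ∑ n ∈ Finset.Ioc a b, (if n.Prime then Real.log n else 0) := fun a b => Finset.sum_filter _ _
  rw [hθ, hθ, e, e, e, ← Finset.sum_Ioc_consecutive _ (Nat.zero_le _) hfl]
  ring

/-- **The size of `{z < p ≤ V}`, core form.** If `|ϑ(t) − t| ≤ C t/(log t)^6` for `t ≥ 2`
(`C ≥ 0`), and at `x`: `L = log x ≥ 1`, `L₂ = log L ≥ 1`, `L₃ = log L₂ ≤ L/2`, `z ≥ 2`, and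
`2048 (1 + C) L₂ e^{√L₂} ≤ L`, then for `z + z/log x ≤ V ≤ x log² x`:
`|#{z < p ≤ V} − (V − z)/log x| ≤ ¼ e^{−√L₂} (V − z)/log x`.
[cite: Maynard2016LargeGaps, §2, Lemma 3 (main term)] -/
theorem card_primes_Ioc_core {C : ℝ} {x : ℕ} {V : ℝ} (hC : 0 ≤ C)
    (hθ : ∀ t : ℝ, 2 ≤ t → |Chebyshev.theta t - t| ≤ C * t / Real.log t ^ (6 : ℝ))
    (hL : 1 ≤ Real.log x) (hL₂ : 1 ≤ Real.log (Real.log x))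
    (hL₃ : Real.log (Real.log (Real.log x)) ≤ Real.log x / 2) (hz2 : 2 ≤ z x)
    (hK : 2048 * (1 + C) * Real.log (Real.log x) *
      Real.exp ((Real.log (Real.log x)) ^ ((1 : ℝ) / 2)) ≤ Real.log x)
    (hV1 : z x + z x / Real.log x ≤ V) (hV2 : V ≤ (x : ℝ) * Real.log x ^ 2) :
    |((((Finset.Ioc ⌊z x⌋₊ ⌊V⌋₊).filter Nat.Prime).card : ℝ)) - (V - z x) / Real.log x| ≤
      Real.exp (-(Real.log (Real.log x)) ^ ((1 : ℝ) / 2)) / 4 * ((V - z x) / Real.log x) := by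
  -- notation
  set L := Real.log (x : ℝ) with hLdef
  set L₂ := Real.log L with hL₂def
  set L₃ := Real.log L₂ with hL₃def
  set e := Real.exp (L₂ ^ ((1 : ℝ) / 2)) with hedef
  set T := (Finset.Ioc ⌊z x⌋₊ ⌊V⌋₊).filter Nat.Prime with hT
  set N : ℝ := (T.card : ℝ) with hN
  have hL0 : 0 < L := by linarith
  have hL₂0 : 0 < L₂ := by linarith
  have he1 : 1 ≤ e := by
    rw [hedef]; exact Real.one_le_exp (Real.rpow_nonneg hL₂0.le _)
  have he0 : 0 < e := by linarith
  have hη : Real.exp (-L₂ ^ ((1 : ℝ) / 2)) = 1 / e := by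
    rw [hedef, Real.exp_neg, inv_eq_one_div]
  -- `x`, `z`
  have hx1 : (1 : ℝ) < x := by
    by_contra h
    have : Real.log (x : ℝ) ≤ 0 := Real.log_nonpos (Nat.cast_nonneg x) (not_lt.1 h)
    linarith
  have hx0 : (0 : ℝ) < x := by linarith
  have hzdef : z x = (x : ℝ) / L₂ := by rw [z]
  have hz0 : 0 < z x := by linarith
  have hzx : z x ≤ x := by rw [hzdef]; exact div_le_self hx0.le hL₂
  have hlogz : Real.log (z x) = L - L₃ := by
    rw [hzdef, Real.log_div hx0.ne' hL₂0.ne']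
  have hVz : z x / L ≤ V - z x := by linarith
  have hVz0 : 0 < V - z x := lt_of_lt_of_le (div_pos hz0 hL0) hVz
  have hV0 : 0 < V := by linarith
  have hzV : z x ≤ V := by linarith
  -- `log z ≥ L/2`, `log V ≤ L + 2 L₂`
  have hlogz_ge : L / 2 ≤ Real.log (z x) := by rw [hlogz]; linarith
  have hlogV_ge : L / 2 ≤ Real.log V := hlogz_ge.trans (Real.log_le_log hz0 hzV)
  have hlogV_le : Real.log V ≤ L + 2 * L₂ := by
    calc Real.log V ≤ Real.log ((x : ℝ) * Real.log x ^ 2) := Real.log_le_log hV0 hV2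
      _ = L + 2 * L₂ := by
          rw [Real.log_mul hx0.ne' (by positivity), Real.log_pow]; push_cast; ring
  have hlogV0 : 0 < Real.log V := by linarith
  have hlogz0 : 0 < Real.log (z x) := by linarith
  -- the smallness conditions from `hK`
  have hKa : 32 * L₂ * e ≤ L := by
    have : 32 * L₂ * e ≤ 2048 * (1 + C) * L₂ * e := by
      have : (32 : ℝ) ≤ 2048 * (1 + C) := by linarith
      exact mul_le_mul_of_nonneg_right (mul_le_mul_of_nonneg_right this hL₂0.le) he0.le
    linarith
  have hKb : 16 * L₃ * e ≤ L := by
    have hL₃L₂ : L₃ ≤ L₂ := by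
      rw [hL₃def]; exact (Real.log_le_sub_one_of_pos hL₂0).trans (by linarith)
    have : 16 * L₃ * e ≤ 32 * L₂ * e := by
      apply mul_le_mul_of_nonneg_right _ he0.le; linarith
    linarith
  have hKc : 2048 * C * L₂ * e ≤ L ^ 3 := by
    have h1 : 2048 * C * L₂ * e ≤ 2048 * (1 + C) * L₂ * e := by
      apply mul_le_mul_of_nonneg_right _ he0.le
      apply mul_le_mul_of_nonneg_right _ hL₂0.le
      linarith
    have h2 : L ≤ L ^ 3 := by
      calc L = L * 1 * 1 := by ring
        _ ≤ L * L * L := mul_le_mul (mul_le_mul_of_nonneg_left hL hL0.le) hL zero_le_one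
            (by positivity)
        _ = L ^ 3 := by ring
    linarith
  -- `S = ϑ(V) − ϑ(z)` and its comparison with `N`
  set S := Chebyshev.theta V - Chebyshev.theta (z x) with hSdef
  have hS : S = ∑ p ∈ T, Real.log p := by rw [hSdef, hT]; exact theta_sub_theta_eq₆ hzV
  have hmemT : ∀ p ∈ T, z x < p ∧ (p : ℝ) ≤ V ∧ 0 < (p : ℝ) := by
    intro p hp
    rw [hT, mem_filter, mem_Ioc] at hp
    refine ⟨(Nat.floor_lt hz0.le).1 hp.1.1, ?_, Nat.cast_pos.2 hp.2.pos⟩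
    calc (p : ℝ) ≤ ⌊V⌋₊ := by exact_mod_cast hp.1.2
      _ ≤ V := Nat.floor_le hV0.le
  have hSup : S ≤ N * Real.log V := by
    rw [hS]
    calc ∑ p ∈ T, Real.log p ≤ ∑ p ∈ T, Real.log V :=
          sum_le_sum fun p hp => Real.log_le_log (hmemT p hp).2.2 (hmemT p hp).2.1
      _ = N * Real.log V := by rw [sum_const, nsmul_eq_mul]
  have hSlo : N * Real.log (z x) ≤ S := by
    rw [hS]
    calc N * Real.log (z x) = ∑ p ∈ T, Real.log (z x) := by rw [sum_const, nsmul_eq_mul]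
      _ ≤ ∑ p ∈ T, Real.log p :=
          sum_le_sum fun p hp => Real.log_le_log hz0 (hmemT p hp).1.le
  -- the error `|S − (V − z)| ≤ 128 C x / L⁴ ≤ (η/4)(V − z)`
  have h6 : ∀ t : ℝ, Real.log t ^ (6 : ℝ) = Real.log t ^ 6 := fun t => by
    rw [show (6 : ℝ) = ((6 : ℕ) : ℝ) by norm_num, Real.rpow_natCast]
  have hpow : ∀ t : ℝ, L / 2 ≤ Real.log t → L ^ 6 / 64 ≤ Real.log t ^ 6 := by
    intro t ht
    have : (L / 2) ^ 6 ≤ Real.log t ^ 6 := pow_le_pow_left₀ (by positivity) ht 6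
    calc L ^ 6 / 64 = (L / 2) ^ 6 := by ring
      _ ≤ _ := this
  have hEV : |Chebyshev.theta V - V| ≤ 64 * C * x / L ^ 4 := by
    have h1 := hθ V (by linarith)
    rw [h6] at h1
    refine h1.trans ?_
    have hp0 : 0 < L ^ 6 / 64 := by positivity
    calc C * V / Real.log V ^ 6 ≤ C * ((x : ℝ) * L ^ 2) / (L ^ 6 / 64) := by
          calc C * V / Real.log V ^ 6 ≤ C * V / (L ^ 6 / 64) :=
                div_le_div_of_nonneg_left (by positivity) hp0 (hpow V hlogV_ge)
            _ ≤ C * ((x : ℝ) * L ^ 2) / (L ^ 6 / 64) :=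
                div_le_div_of_nonneg_right (mul_le_mul_of_nonneg_left hV2 hC) hp0.le
      _ = 64 * C * x / L ^ 4 := by field_simp
  have hEz : |Chebyshev.theta (z x) - z x| ≤ 64 * C * x / L ^ 4 := by
    have h1 := hθ (z x) hz2
    rw [h6] at h1
    refine h1.trans ?_
    have hp0 : 0 < L ^ 6 / 64 := by positivity
    calc C * z x / Real.log (z x) ^ 6 ≤ C * x / (L ^ 6 / 64) := by
          calc C * z x / Real.log (z x) ^ 6 ≤ C * z x / (L ^ 6 / 64) :=
                div_le_div_of_nonneg_left (by positivity) hp0 (hpow (z x) hlogz_ge)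
            _ ≤ C * x / (L ^ 6 / 64) :=
                div_le_div_of_nonneg_right (mul_le_mul_of_nonneg_left hzx hC) hp0.le
      _ = 64 * C * x / L ^ 6 := by field_simp
      _ ≤ 64 * C * x / L ^ 4 := by
          apply div_le_div_of_nonneg_left (by positivity) (by positivity)
          calc L ^ 4 = L ^ 4 * 1 := by ring
            _ ≤ L ^ 4 * L ^ 2 := mul_le_mul_of_nonneg_left (one_le_pow₀ hL) (by positivity)
            _ = L ^ 6 := by ring
  have hE : |S - (V - z x)| ≤ 128 * C * x / L ^ 4 := by
    have : S - (V - z x) = (Chebyshev.theta V - V) - (Chebyshev.theta (z x) - z x) := by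
      rw [hSdef]; ring
    rw [this]
    refine (abs_sub _ _).trans ?_
    have : 128 * C * (x : ℝ) / L ^ 4 = 64 * C * x / L ^ 4 + 64 * C * x / L ^ 4 := by ring
    rw [this]; exact add_le_add hEV hEz
  -- `η = 1/(4e)`; `128 C x/L⁴ ≤ (η/4)(V − z)`
  set η : ℝ := 1 / (4 * e) with hηdef
  have hη0 : 0 < η := by positivity
  have hη1 : η ≤ 1 / 4 := by
    rw [hηdef]; exact div_le_div_of_nonneg_left zero_le_one (by norm_num) (by linarith)
  have hρ₁ : 128 * C * x / L ^ 4 ≤ η / 4 * (V - z x) := by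
    have h1 : η / 4 * (z x / L) ≤ η / 4 * (V - z x) := mul_le_mul_of_nonneg_left hVz (by positivity)
    refine le_trans ?_ h1
    have key : 128 * C * (x : ℝ) / L ^ 4 =
        (2048 * C * L₂ * e) * ((x : ℝ) / (16 * e * L₂ * L ^ 4)) := by
      field_simp; ring
    have key2 : η / 4 * (z x / L) = L ^ 3 * ((x : ℝ) / (16 * e * L₂ * L ^ 4)) := by
      rw [hzdef, hηdef]; field_simp; norm_num
    rw [key, key2]
    exact mul_le_mul_of_nonneg_right hKc (by positivity)
  have hSle : S ≤ (V - z x) * (1 + η / 4) := by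
    have h1 := (abs_le.1 hE).2
    have : (V - z x) * (1 + η / 4) = (V - z x) + η / 4 * (V - z x) := by ring
    linarith
  have hSge : (V - z x) * (1 - η / 4) ≤ S := by
    have h1 := (abs_le.1 hE).1
    have : (V - z x) * (1 - η / 4) = (V - z x) - η / 4 * (V - z x) := by ring
    linarith
  -- `log z ≥ L(1 − η/4)` and `log V ≤ L(1 + η/4)`
  have hρ₂ : L * (1 - η / 4) ≤ Real.log (z x) := by
    rw [hlogz]
    have : L₃ ≤ L * (η / 4) := by
      rw [hηdef]
      have : L * (1 / (4 * e) / 4) = L / (16 * e) := by field_simp; ring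
      rw [this, le_div_iff₀ (by positivity)]; linarith
    linarith
  have hρ₃ : Real.log V ≤ L * (1 + η / 4) := by
    have : 2 * L₂ ≤ L * (η / 4) := by
      rw [hηdef]
      have : L * (1 / (4 * e) / 4) = L / (16 * e) := by field_simp; ring
      rw [this, le_div_iff₀ (by positivity)]; linarith
    linarith
  have hN0 : 0 ≤ N := Nat.cast_nonneg _
  -- upper bound `N L ≤ (V − z)(1 + η)`
  have hup : N * L ≤ (V - z x) * (1 + η) := by
    have h1 : N * (L * (1 - η / 4)) ≤ (V - z x) * (1 + η / 4) :=
      (mul_le_mul_of_nonneg_left hρ₂ hN0).trans (hSlo.trans hSle)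
    have h2 : (V - z x) * (1 + η / 4) ≤ (V - z x) * (1 + η) * (1 - η / 4) := by
      rw [mul_assoc]
      apply mul_le_mul_of_nonneg_left _ hVz0.le
      have hsq : η * η ≤ η * (1 / 4) := mul_le_mul_of_nonneg_left hη1 hη0.le
      have : (1 + η) * (1 - η / 4) = 1 + η / 4 + (η / 2 - η * η / 4) := by ring
      rw [this]; linarith
    have h14 : 0 < 1 - η / 4 := by linarith
    have h3 : N * L * (1 - η / 4) ≤ (V - z x) * (1 + η) * (1 - η / 4) := by
      rw [mul_assoc]; exact h1.trans h2
    exact le_of_mul_le_mul_right h3 h14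
  -- lower bound `(V − z)(1 − η) ≤ N L`
  have hlo : (V - z x) * (1 - η) ≤ N * L := by
    have h1 : (V - z x) * (1 - η / 4) ≤ N * (L * (1 + η / 4)) :=
      hSge.trans (hSup.trans (mul_le_mul_of_nonneg_left hρ₃ hN0))
    have h2 : (V - z x) * (1 - η) * (1 + η / 4) ≤ (V - z x) * (1 - η / 4) := by
      rw [mul_assoc]
      apply mul_le_mul_of_nonneg_left _ hVz0.le
      have hsq : 0 ≤ η * η := mul_self_nonneg η
      have : (1 - η) * (1 + η / 4) = 1 - η / 4 - (η / 2 + η * η / 4) := by ring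
      rw [this]; linarith
    have h14 : 0 < 1 + η / 4 := by linarith
    have h3 : (V - z x) * (1 - η) * (1 + η / 4) ≤ N * L * (1 + η / 4) := by
      rw [mul_assoc (N : ℝ)]; exact h2.trans h1
    exact le_of_mul_le_mul_right h3 h14
  -- conclude
  have hηe : Real.exp (-L₂ ^ ((1 : ℝ) / 2)) / 4 = η := by
    rw [hη, hηdef]; field_simp
  rw [hηe, abs_le]
  constructor
  · -- `−(η M) ≤ N − M`
    have h1 : (V - z x) / L * (1 - η) ≤ N := by
      rw [div_mul_eq_mul_div, div_le_iff₀ hL0]; exact hlo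
    have : (V - z x) / L * (1 - η) = (V - z x) / L - η * ((V - z x) / L) := by ring
    linarith
  · have h1 : N ≤ (V - z x) / L * (1 + η) := by
      rw [div_mul_eq_mul_div, le_div_iff₀ hL0]; exact hup
    have : (V - z x) / L * (1 + η) = (V - z x) / L + η * ((V - z x) / L) := by ring
    linarith

/-- The growth facts of `card_primes_Ioc_core`, for all large `x : ℕ`. [folklore] -/
private theorem eventually_growth₆ (C : ℝ) :
    ∀ᶠ x : ℕ in atTop,
      1 ≤ Real.log x ∧ 1 ≤ Real.log (Real.log x) ∧ 0 ≤ Real.log (Real.log (Real.log x)) ∧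
      Real.log (Real.log (Real.log x)) ≤ Real.log x / 2 ∧ 2 ≤ z x ∧
      2048 * (1 + C) * Real.log (Real.log x) *
        Real.exp ((Real.log (Real.log x)) ^ ((1 : ℝ) / 2)) ≤ Real.log x := by
  -- in the variable `u = log₂ X`: `log(2048(1+C)') + log u + √u ≤ u` for large `u`
  set K : ℝ := 2048 * (1 + |C|) + 1 with hK
  have hK1 : 1 ≤ K := by rw [hK]; have := abs_nonneg C; linarith
  have hlogK : 0 ≤ Real.log K := Real.log_nonneg hK1
  have hT₂ : Tendsto (fun X : ℝ => Real.log (Real.log X)) atTop atTop :=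
    Real.tendsto_log_atTop.comp Real.tendsto_log_atTop
  have hT₃ : Tendsto (fun X : ℝ => Real.log (Real.log (Real.log X))) atTop atTop :=
    Real.tendsto_log_atTop.comp hT₂
  have hlin2 := Real.tendsto_log_atTop.eventually
    (Real.isLittleO_log_id_atTop.bound (show (0 : ℝ) < 1 / 4 by norm_num))
  have hreal : ∀ᶠ X : ℝ in atTop,
      1 ≤ Real.log X ∧ 1 ≤ Real.log (Real.log X) ∧ 0 ≤ Real.log (Real.log (Real.log X)) ∧
      Real.log (Real.log (Real.log X)) ≤ Real.log X / 2 ∧ 2 ≤ X / Real.log (Real.log X) ∧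
      2048 * (1 + C) * Real.log (Real.log X) *
        Real.exp ((Real.log (Real.log X)) ^ ((1 : ℝ) / 2)) ≤ Real.log X := by
    filter_upwards [Real.tendsto_log_atTop.eventually_ge_atTop 1, hT₂.eventually_ge_atTop 1,
      hT₃.eventually_ge_atTop 0, hT₂.eventually_ge_atTop (8 * Real.log K + 16), hlin2,
      eventually_ge_atTop (1 : ℝ)] with X hL1 hL₂1 hL₃0 hu hlin2X hX1
    have hL0 : 0 < Real.log X := by linarith
    have hL₂0 : 0 < Real.log (Real.log X) := by linarith
    set u := Real.log (Real.log X) with hudef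
    -- `log₂ X ≤ log X / 4`, hence `log₃ X ≤ log₂ X ≤ log X / 2` and `X/log₂ X ≥ 2`
    have hlin : u ≤ Real.log X / 4 := by
      rw [Real.norm_eq_abs, Real.norm_eq_abs, id, abs_of_nonneg hL₂0.le,
        abs_of_nonneg hL0.le] at hlin2X
      linarith
    have hL₃le : Real.log u ≤ u := (Real.log_le_sub_one_of_pos hL₂0).trans (by linarith)
    have hlogX_le : Real.log X ≤ X := by
      have := Real.log_le_sub_one_of_pos (show (0 : ℝ) < X by linarith); linarith
    refine ⟨hL1, hL₂1, hL₃0, by linarith, ?_, ?_⟩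
    · rw [le_div_iff₀ hL₂0]; linarith
    · -- `2048(1+C) u e^{√u} ≤ K u e^{√u} ≤ e^{u} = log X` iff `log K + log u + √u ≤ u`
      have hsq' : Real.sqrt u ≤ u / 8 + 2 := by
        have h1 := Real.mul_self_sqrt hL₂0.le
        have h2 := sq_nonneg (Real.sqrt u - 4)
        have : (Real.sqrt u - 4) ^ 2 = Real.sqrt u * Real.sqrt u - 8 * Real.sqrt u + 16 := by ring
        linarith
      have hsq : u ^ ((1 : ℝ) / 2) ≤ u / 8 + 2 := by rw [← Real.sqrt_eq_rpow]; exact hsq'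
      have hlogu : Real.log u ≤ u / 4 + 2 := by
        have h1 : Real.log (Real.sqrt u) = Real.log u / 2 := Real.log_sqrt hL₂0.le
        have h2 : Real.log (Real.sqrt u) ≤ Real.sqrt u - 1 :=
          Real.log_le_sub_one_of_pos (Real.sqrt_pos.2 hL₂0)
        linarith
      have hexp : K * u * Real.exp (u ^ ((1 : ℝ) / 2)) ≤ Real.exp u := by
        have h1 : K * u * Real.exp (u ^ ((1 : ℝ) / 2)) =
            Real.exp (Real.log K + Real.log u + u ^ ((1 : ℝ) / 2)) := by
          rw [Real.exp_add, Real.exp_add, Real.exp_log (by linarith), Real.exp_log hL₂0]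
        rw [h1, Real.exp_le_exp]
        linarith
      have hlogX : Real.exp u = Real.log X := by rw [hudef, Real.exp_log hL0]
      rw [hlogX] at hexp
      refine le_trans ?_ hexp
      apply mul_le_mul_of_nonneg_right _ (Real.exp_pos _).le
      apply mul_le_mul_of_nonneg_right _ hL₂0.le
      rw [hK]; have := le_abs_self C; linarith
  filter_upwards [tendsto_natCast_atTop_atTop.eventually hreal] with x hx
  refine ⟨hx.1, hx.2.1, hx.2.2.1, hx.2.2.2.1, ?_, hx.2.2.2.2.2⟩
  rw [z]; exact hx.2.2.2.2.1

/-- **The size of `{z < p ≤ V}`** (the `X` of Maynard's Lemma 3), unconditionally: for all large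
`x`, for every `z + z/log x ≤ V ≤ x log² x`,
`|#{z < p ≤ V} − (V − z)/log x| ≤ ¼ e^{−√(log₂ x)} (V − z)/log x`, from the prime number theorem with
de la Vallée Poussin's error term (`ChebyshevThetaDeLaValleePoussin_holds`).
[cite: Maynard2016LargeGaps, §2, Lemma 3 (main term)] -/
theorem eventually_card_primes_Ioc :
    ∀ᶠ x : ℕ in atTop, ∀ V : ℝ, z x + z x / Real.log x ≤ V → V ≤ (x : ℝ) * Real.log x ^ 2 →
      |((((Finset.Ioc ⌊z x⌋₊ ⌊V⌋₊).filter Nat.Prime).card : ℝ)) - (V - z x) / Real.log x| ≤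
        Real.exp (-(Real.log (Real.log x)) ^ ((1 : ℝ) / 2)) / 4 * ((V - z x) / Real.log x) := by
  obtain ⟨C, hC⟩ :=
    Literature.NumberTheory.LFunctions.ChebyshevThetaDeLaValleePoussin_holds.logPow 6
  set C' : ℝ := max C 0 with hC'
  have hC'0 : 0 ≤ C' := le_max_right _ _
  have hθ' : ∀ t : ℝ, 2 ≤ t → |Chebyshev.theta t - t| ≤ C' * t / Real.log t ^ (6 : ℝ) := by
    intro t ht
    refine (hC t ht).trans ?_
    have hl : 0 < Real.log t ^ (6 : ℝ) := Real.rpow_pos_of_pos (Real.log_pos (by linarith)) _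
    exact div_le_div_of_nonneg_right (mul_le_mul_of_nonneg_right (le_max_left C 0) (by linarith))
      hl.le
  filter_upwards [eventually_growth₆ C'] with x hx
  intro V hV1 hV2
  exact card_primes_Ioc_core hC'0 hθ' hx.1 hx.2.1 hx.2.2.2.1 hx.2.2.2.2.1 hx.2.2.2.2.2 hV1 hV2

end Maynard2016

end Literature.NumberTheory.Sieve
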